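import Summits.RiemannHypothesis.RiemannHypothesis.Theorems.SuzukiFlowPairingCausalContinuity
import Summits.RiemannHypothesis.RiemannHypothesis.Theorems.SuzukiFlowPairingGaussOuter
import Summits.RiemannHypothesis.RiemannHypothesis.Theorems.SuzukiFlowPairingPrimePiece
import Summits.RiemannHypothesis.RiemannHypothesis.Theorems.SuzukiFlowKernelReal

/-!
# Operator side of `FlowPairing`, assembled: `⟨𝖪_θ[t]f, 𝒥_θ[t]f⟩ = ⟨k, φ⟩` (column DBR; RH-FREE)

RH-FREE throughout; nothing here bears on the truth of RH.  For `θ > 1`, `f ∈ L¹(−t,t)`, `G = 𝖪_θ[t]f` and the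
window pairing `Φ(v) = ∫_{(−t,t)} G(x)G(x−v)dx` (`= (g_θ ⋆ g̃_θ)(v)` for `v ≥ 0`, `Theorems.SuzukiFlowPairingCausality`),
the five pieces of the flow kernel `J_θ = k ∗ K_θ` (`Theorems.SuzukiFlowKernelReal.flowKernel_eq`) are carried
through the two window integrations by `Theorems.SuzukiFlowPairingPolarPiece` (exponential pieces),
`…PrimePiece`, `…GaussInner/Outer` (digamma series); this file adds the generic continuity of window operators
with continuous kernels and ASSEMBLES:

* **`integral_winOp_mul_winOp_flowKernel`** —
  `∫_{(−t,t)} G·(𝒥_θ[t]f) = −2∫₀^∞e^{−v/2}Φ − 2∫₀^∞e^{v/2}Φ + (log π + γ)Φ(0)`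
  `  − Σ'_k (Φ(0)/(k+1) − 2∫₀^∞e^{−(2k+½)v}Φ) + 2Σ'_n Λ(n)n^{−1/2}Φ(log n)`.

With `Theorems.SuzukiFlowPairingWeilValue.weilQuadratic_winOut_eq` (the Weil side in the same `x`-side
quantities) only the real/complex matching of the two sides remains for `FlowPairing`.

References: [Su20] M. Suzuki, ASPM 84 (2020); E. Bombieri, Rend. Lincei (9) 11 (2000), Thm 2.
-/

noncomputable section

-- D-0017: `Summit.<S>.<S>.…` is the designed namespace of a single-problem summit.
set_option linter.dupNamespace false

open Complex MeasureTheory Set Filter Topology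
open scoped Real ArithmeticFunction.vonMangoldt

namespace Summit.RiemannHypothesis.RiemannHypothesis.Theorems.SuzukiThetaFlow

open Literature.NumberTheory.LFunctions
open Summit.RiemannHypothesis.RiemannHypothesis.Theorems.SuzukiKernelSemigroup
open Summit.RiemannHypothesis.RiemannHypothesis.Theorems.SuzukiFlowPairing

variable {θ t : ℝ} {f : ℝ → ℝ}

/-- RH-FREE.  **A window operator with continuous kernel has continuous output**: for `J` continuous and
`f ∈ L¹(−t,t)`, `x ↦ ∫_{(−t,t)} J(x+y) f(y) dy` is continuous (dominated convergence, `J` bounded on compacts). -/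
theorem continuous_winOp_of_continuous {J : ℝ → ℝ} (hJ : Continuous J) (hf : IntegrableOn f (Ioo (-t) t)) :
    Continuous (winOp J t f) := by
  refine continuous_iff_continuousAt.2 fun x₀ ↦ ?_
  obtain ⟨M, hM⟩ := (isCompact_Icc (a := x₀ - 1 - |t|) (b := x₀ + 1 + |t|)).exists_bound_of_continuousOn
    hJ.continuousOn
  unfold winOp
  refine continuousAt_of_dominated (bound := fun y ↦ M * ‖f y‖) ?_ ?_ (hf.norm.const_mul M) ?_
  · exact Eventually.of_forall fun x ↦
      ((hJ.comp (continuous_const.add continuous_id)).aestronglyMeasurable.mul hf.aestronglyMeasurable)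
  · have hnhds : Ioo (x₀ - 1) (x₀ + 1) ∈ 𝓝 x₀ := Ioo_mem_nhds (by linarith) (by linarith)
    filter_upwards [hnhds] with x hx
    refine (ae_restrict_iff' measurableSet_Ioo).2 (Eventually.of_forall fun y hy ↦ ?_)
    rw [norm_mul]
    refine mul_le_mul_of_nonneg_right (hM (x + y) ⟨?_, ?_⟩) (norm_nonneg _)
    · linarith [hx.1, hy.1, le_abs_self t, neg_abs_le t, abs_nonneg t, neg_le_abs t]
    · linarith [hx.2, hy.2, le_abs_self t]
  · exact Eventually.of_forall fun y ↦ ((hJ.comp (continuous_id.add continuous_const)).mul continuous_const).continuousAt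

/-- RH-FREE.  The flow kernel is continuous (tree `continuous_flowKernel`, restated for `flowKernel`). -/
theorem continuous_flowKernel' (hθ : 1 < θ) : Continuous (flowKernel θ) := continuous_flowKernel hθ

/-- RH-FREE.  `y ↦ J(x+y) f(y)` is integrable on the window for continuous `J`. -/
theorem integrableOn_continuous_mul {J : ℝ → ℝ} (hJ : Continuous J) (hf : IntegrableOn f (Ioo (-t) t)) (x : ℝ) :
    IntegrableOn (fun y ↦ J (x + y) * f y) (Ioo (-t) t) := by
  have hc : Continuous fun y : ℝ ↦ J (x + y) := hJ.comp (continuous_const.add continuous_id)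
  obtain ⟨M, hM⟩ := (isCompact_Icc (a := -t) (b := t)).exists_bound_of_continuousOn hc.continuousOn
  exact Integrable.bdd_mul (c := M) hf hc.aestronglyMeasurable
    ((ae_restrict_iff' measurableSet_Ioo).2 (Eventually.of_forall fun y hy ↦ hM y (Ioo_subset_Icc_self hy)))

/-- RH-FREE.  The prime piece is integrable against `f` on the window (it is a finite sum of shifted kernels there). -/
theorem integrableOn_primePiece_mul (hθ : 1 < θ) (hf : IntegrableOn f (Ioo (-t) t)) {x : ℝ} (hx : x ≤ t) :
    IntegrableOn (fun y ↦ (∑' n : ℕ, (Λ n : ℝ) * (n : ℝ) ^ (-(1 / 2 : ℝ)) * limKernel θ (x + y - Real.log n)) * f y)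
      (Ioo (-t) t) := by
  have hfin : IntegrableOn (fun y ↦ ∑ n ∈ Finset.range (⌈Real.exp (2 * |t|)⌉₊ + 1),
      ((Λ n : ℝ) * (n : ℝ) ^ (-(1 / 2 : ℝ))) * (limKernel θ (x - Real.log n + y) * f y)) (Ioo (-t) t) := by
    refine integrable_finsetSum _ fun n _ ↦ ?_
    exact (integrableOn_kernel_mul hθ hf (x - Real.log n)).const_mul _
  refine hfin.congr_fun (fun y hy ↦ ?_) measurableSet_Ioo
  rw [primePiece_eq_sum hθ (by linarith [hy.2, le_abs_self t]), Finset.sum_mul]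
  refine Finset.sum_congr rfl fun n _ ↦ ?_
  rw [show x - Real.log n + y = x + y - Real.log n by ring]
  ring

/-- **RH-FREE · the inner window integral of the flow kernel, split into its five pieces**: for `x ≤ t`,
`(𝒥_θ[t]f)(x) = −2A_{−½}(x) − 2A_{½}(x) + (log π+γ)G(x) − D(x) + 2P(x)` with the pieces left as window
integrals (`A_a(x) = ∫(∫₀^∞e^{av}K_θ(x+y−v)dv)f(y)dy`, `D` the digamma series, `P` the prime series). -/
theorem winOp_flowKernel_eq (hθ : 1 < θ) (hf : IntegrableOn f (Ioo (-t) t)) {x : ℝ} (hx : x ≤ t) :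
    winOp (flowKernel θ) t f x =
      -2 * (∫ y in Ioo (-t) t, (∫ v in Ioi (0 : ℝ), Real.exp (-(1 / 2) * v) * limKernel θ (x + y - v)) * f y) +
      (-2) * (∫ y in Ioo (-t) t, (∫ v in Ioi (0 : ℝ), Real.exp (1 / 2 * v) * limKernel θ (x + y - v)) * f y) +
      (Real.log Real.pi + Real.eulerMascheroniConstant) * winOp (limKernel θ) t f x -
      (∫ y in Ioo (-t) t, (∑' k : ℕ, (limKernel θ (x + y) / ((k : ℝ) + 1) -
        2 * ∫ v in Ioi (0 : ℝ), Real.exp ((-2 * (k : ℝ) - 1 / 2) * v) * limKernel θ (x + y - v))) * f y) +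
      2 * (∫ y in Ioo (-t) t, (∑' n : ℕ, (Λ n : ℝ) * (n : ℝ) ^ (-(1 / 2 : ℝ)) * limKernel θ (x + y - Real.log n)) * f y) := by
  have hA1 := integrableOn_expPiece_mul hθ hf (-(1 / 2)) x
  have hA2 := integrableOn_expPiece_mul hθ hf (1 / 2) x
  have hK := integrableOn_kernel_mul hθ hf x
  have hP := integrableOn_primePiece_mul hθ hf hx
  have hJ := integrableOn_continuous_mul (continuous_flowKernel' hθ) hf x
  -- the digamma series piece is the combination `−J − 2A₋ − 2A₊ + cK + 2P`, hence integrable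
  have hDeq : ∀ y : ℝ, (∑' k : ℕ, (limKernel θ (x + y) / ((k : ℝ) + 1) -
      2 * ∫ v in Ioi (0 : ℝ), Real.exp ((-2 * (k : ℝ) - 1 / 2) * v) * limKernel θ (x + y - v))) * f y =
      -(flowKernel θ (x + y) * f y) + (-2) * ((∫ v in Ioi (0 : ℝ), Real.exp (-(1 / 2) * v) * limKernel θ (x + y - v)) * f y) +
        (-2) * ((∫ v in Ioi (0 : ℝ), Real.exp (1 / 2 * v) * limKernel θ (x + y - v)) * f y) +
        (Real.log Real.pi + Real.eulerMascheroniConstant) * (limKernel θ (x + y) * f y) +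
        2 * ((∑' n : ℕ, (Λ n : ℝ) * (n : ℝ) ^ (-(1 / 2 : ℝ)) * limKernel θ (x + y - Real.log n)) * f y) := by
    intro y
    rw [flowKernel_eq hθ (x + y)]
    ring
  have hD : IntegrableOn (fun y ↦ (∑' k : ℕ, (limKernel θ (x + y) / ((k : ℝ) + 1) -
      2 * ∫ v in Ioi (0 : ℝ), Real.exp ((-2 * (k : ℝ) - 1 / 2) * v) * limKernel θ (x + y - v))) * f y) (Ioo (-t) t) := by
    have h := (((hJ.neg.add (hA1.const_mul (-2))).add (hA2.const_mul (-2))).add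
      (hK.const_mul (Real.log Real.pi + Real.eulerMascheroniConstant))).add (hP.const_mul 2)
    refine h.congr (Eventually.of_forall fun y ↦ ?_)
    simp only [Pi.add_apply, Pi.neg_apply]
    rw [hDeq y]
  -- rewrite the kernel and split
  have hstep : winOp (flowKernel θ) t f x = ∫ y in Ioo (-t) t,
      (-2 * ((∫ v in Ioi (0 : ℝ), Real.exp (-(1 / 2) * v) * limKernel θ (x + y - v)) * f y) +
       (-2) * ((∫ v in Ioi (0 : ℝ), Real.exp (1 / 2 * v) * limKernel θ (x + y - v)) * f y) +
       (Real.log Real.pi + Real.eulerMascheroniConstant) * (limKernel θ (x + y) * f y) -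
       (∑' k : ℕ, (limKernel θ (x + y) / ((k : ℝ) + 1) -
          2 * ∫ v in Ioi (0 : ℝ), Real.exp ((-2 * (k : ℝ) - 1 / 2) * v) * limKernel θ (x + y - v))) * f y +
       2 * ((∑' n : ℕ, (Λ n : ℝ) * (n : ℝ) ^ (-(1 / 2 : ℝ)) * limKernel θ (x + y - Real.log n)) * f y)) := by
    unfold winOp
    refine setIntegral_congr_fun measurableSet_Ioo fun y _ ↦ ?_
    rw [flowKernel_eq hθ (x + y)]
    ring
  rw [hstep, integral_add, integral_sub, integral_add, integral_add, integral_const_mul, integral_const_mul,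
    integral_const_mul, integral_const_mul]
  · rfl
  · exact hA1.const_mul _
  · exact hA2.const_mul _
  · exact (hA1.const_mul _).add (hA2.const_mul _)
  · exact hK.const_mul _
  · exact ((hA1.const_mul _).add (hA2.const_mul _)).add (hK.const_mul _)
  · exact hD
  · exact (((hA1.const_mul _).add (hA2.const_mul _)).add (hK.const_mul _)).sub hD
  · exact hP.const_mul _

/-- **RH-FREE · THE OPERATOR SIDE OF `FlowPairing`**: for `θ > 1`, `f ∈ L¹(−t,t)`, `G = 𝖪_θ[t]f` and
`Φ(v) = ∫_{(−t,t)} G(x)G(x−v)dx`,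
`∫_{(−t,t)} G(x)(𝒥_θ[t]f)(x) dx = −2∫₀^∞e^{−v/2}Φ(v)dv − 2∫₀^∞e^{v/2}Φ(v)dv + (log π + γ)Φ(0)`
`  − Σ'_k (Φ(0)/(k+1) − 2∫₀^∞e^{−(2k+½)v}Φ(v)dv) + 2Σ'_n Λ(n)n^{−1/2}Φ(log n)`
— `2⟨𝖪_θ[t]f, 𝒥_θ[t]f⟩ = 2⟨k, φ⟩` with `φ = g_θ ⋆ g̃_θ` by the pairing lemma.  Nothing here bears on RH. -/
theorem integral_winOp_mul_winOp_flowKernel (hθ : 1 < θ) (hf : IntegrableOn f (Ioo (-t) t)) :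
    ∫ x in Ioo (-t) t, winOp (limKernel θ) t f x * winOp (flowKernel θ) t f x =
      -2 * (∫ v in Ioi (0 : ℝ), Real.exp (-(1 / 2) * v) *
          ∫ x in Ioo (-t) t, winOp (limKernel θ) t f x * winOp (limKernel θ) t f (x - v)) +
      (-2) * (∫ v in Ioi (0 : ℝ), Real.exp (1 / 2 * v) *
          ∫ x in Ioo (-t) t, winOp (limKernel θ) t f x * winOp (limKernel θ) t f (x - v)) +
      (Real.log Real.pi + Real.eulerMascheroniConstant) *
        (∫ x in Ioo (-t) t, winOp (limKernel θ) t f x * winOp (limKernel θ) t f x) -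
      (∑' k : ℕ, ((∫ x in Ioo (-t) t, winOp (limKernel θ) t f x * winOp (limKernel θ) t f x) / ((k : ℝ) + 1) -
        2 * ∫ v in Ioi (0 : ℝ), Real.exp ((-2 * (k : ℝ) - 1 / 2) * v) *
          ∫ x in Ioo (-t) t, winOp (limKernel θ) t f x * winOp (limKernel θ) t f (x - v))) +
      2 * ∑' n : ℕ, (Λ n : ℝ) * (n : ℝ) ^ (-(1 / 2 : ℝ)) *
        ∫ x in Ioo (-t) t, winOp (limKernel θ) t f x * winOp (limKernel θ) t f (x - Real.log n) := by
  have hGc := continuous_winOp hθ hf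
  have hJc := continuous_winOp_of_continuous (continuous_flowKernel' hθ) hf
  -- integrability of the five outer integrands on the window
  have hI1 : IntegrableOn (fun x ↦ winOp (limKernel θ) t f x *
      ∫ y in Ioo (-t) t, (∫ v in Ioi (0 : ℝ), Real.exp (-(1 / 2) * v) * limKernel θ (x + y - v)) * f y) (Ioo (-t) t) :=
    (integrableOn_winOp_mul_expPiece hθ hf (-(1 / 2))).congr_fun (fun x _ ↦ by rw [winOp_expPiece hθ hf])
      measurableSet_Ioo
  have hI2 : IntegrableOn (fun x ↦ winOp (limKernel θ) t f x *
      ∫ y in Ioo (-t) t, (∫ v in Ioi (0 : ℝ), Real.exp (1 / 2 * v) * limKernel θ (x + y - v)) * f y) (Ioo (-t) t) :=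
    (integrableOn_winOp_mul_expPiece hθ hf (1 / 2)).congr_fun (fun x _ ↦ by rw [winOp_expPiece hθ hf])
      measurableSet_Ioo
  have hI3 : IntegrableOn (fun x ↦ winOp (limKernel θ) t f x * winOp (limKernel θ) t f x) (Ioo (-t) t) :=
    ((hGc.mul hGc).continuousOn.integrableOn_compact isCompact_Icc).mono_set Ioo_subset_Icc_self
  have hPc : Continuous fun x : ℝ ↦ ∑ n ∈ Finset.range (⌈Real.exp (2 * |t|)⌉₊ + 1),
      (Λ n : ℝ) * (n : ℝ) ^ (-(1 / 2 : ℝ)) * winOp (limKernel θ) t f (x - Real.log n) :=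
    continuous_finsetSum _ fun n _ ↦ continuous_const.mul (hGc.comp (continuous_id.sub continuous_const))
  have hI5 : IntegrableOn (fun x ↦ winOp (limKernel θ) t f x *
      ∫ y in Ioo (-t) t, (∑' n : ℕ, (Λ n : ℝ) * (n : ℝ) ^ (-(1 / 2 : ℝ)) * limKernel θ (x + y - Real.log n)) * f y)
      (Ioo (-t) t) :=
    (((hGc.mul hPc).continuousOn.integrableOn_compact isCompact_Icc).mono_set Ioo_subset_Icc_self).congr_fun
      (fun x hx ↦ by simp only [Pi.mul_apply]; rw [winOp_primePiece hθ hf hx.2.le]) measurableSet_Ioo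
  have hI4 : IntegrableOn (fun x ↦ winOp (limKernel θ) t f x *
      ∫ y in Ioo (-t) t, (∑' k : ℕ, (limKernel θ (x + y) / ((k : ℝ) + 1) -
        2 * ∫ v in Ioi (0 : ℝ), Real.exp ((-2 * (k : ℝ) - 1 / 2) * v) * limKernel θ (x + y - v))) * f y)
      (Ioo (-t) t) := by
    -- on the window the digamma piece is `−2A₋ − 2A₊ + cG + 2P − 𝒥f`, by `winOp_flowKernel_eq`
    have h := (((hI1.const_mul (-2)).add (hI2.const_mul (-2))).add (hI3.const_mul
      (Real.log Real.pi + Real.eulerMascheroniConstant))).add ((hI5.const_mul 2).sub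
      (((hGc.mul hJc).continuousOn.integrableOn_compact isCompact_Icc).mono_set Ioo_subset_Icc_self))
    refine IntegrableOn.congr_fun h (fun x hx ↦ ?_) measurableSet_Ioo
    have he := winOp_flowKernel_eq hθ hf hx.2.le
    simp only [Pi.add_apply, Pi.sub_apply, Pi.mul_apply]
    linear_combination (-(winOp (limKernel θ) t f x)) * he
  -- substitute the inner split and integrate term by term
  have hstep : ∫ x in Ioo (-t) t, winOp (limKernel θ) t f x * winOp (flowKernel θ) t f x =
      ∫ x in Ioo (-t) t,
        (-2 * (winOp (limKernel θ) t f x *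
          ∫ y in Ioo (-t) t, (∫ v in Ioi (0 : ℝ), Real.exp (-(1 / 2) * v) * limKernel θ (x + y - v)) * f y) +
        (-2) * (winOp (limKernel θ) t f x *
          ∫ y in Ioo (-t) t, (∫ v in Ioi (0 : ℝ), Real.exp (1 / 2 * v) * limKernel θ (x + y - v)) * f y) +
        (Real.log Real.pi + Real.eulerMascheroniConstant) * (winOp (limKernel θ) t f x * winOp (limKernel θ) t f x) -
        (winOp (limKernel θ) t f x *
          ∫ y in Ioo (-t) t, (∑' k : ℕ, (limKernel θ (x + y) / ((k : ℝ) + 1) -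
            2 * ∫ v in Ioi (0 : ℝ), Real.exp ((-2 * (k : ℝ) - 1 / 2) * v) * limKernel θ (x + y - v))) * f y) +
        2 * (winOp (limKernel θ) t f x *
          ∫ y in Ioo (-t) t, (∑' n : ℕ, (Λ n : ℝ) * (n : ℝ) ^ (-(1 / 2 : ℝ)) * limKernel θ (x + y - Real.log n)) * f y)) := by
    refine setIntegral_congr_fun measurableSet_Ioo fun x hx ↦ ?_
    rw [winOp_flowKernel_eq hθ hf hx.2.le]
    ring
  rw [hstep, integral_add, integral_sub, integral_add, integral_add, integral_const_mul, integral_const_mul,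
    integral_const_mul, integral_const_mul, integral_winOp_mul_winOp_expPiece hθ hf,
    integral_winOp_mul_winOp_expPiece hθ hf, integral_winOp_mul_winOp_primePiece hθ hf]
  · -- the digamma series: inner then outer
    have hG : ∫ x in Ioo (-t) t, winOp (limKernel θ) t f x *
        ∫ y in Ioo (-t) t, (∑' k : ℕ, (limKernel θ (x + y) / ((k : ℝ) + 1) -
          2 * ∫ v in Ioi (0 : ℝ), Real.exp ((-2 * (k : ℝ) - 1 / 2) * v) * limKernel θ (x + y - v))) * f y =
        ∫ x in Ioo (-t) t, winOp (limKernel θ) t f x *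
          ∑' k : ℕ, (winOp (limKernel θ) t f x / ((k : ℝ) + 1) -
            2 * ∫ v in Ioi (0 : ℝ), Real.exp ((-2 * (k : ℝ) - 1 / 2) * v) * winOp (limKernel θ) t f (x - v)) := by
      refine setIntegral_congr_fun measurableSet_Ioo fun x hx ↦ ?_
      rw [integral_gaussSeries_mul_eq_tsum hθ hf hx.2.le]
    rw [hG, integral_winOp_mul_gaussSeries hθ hf]
  · exact hI1.const_mul _
  · exact hI2.const_mul _
  · exact (hI1.const_mul _).add (hI2.const_mul _)
  · exact hI3.const_mul _
  · exact ((hI1.const_mul _).add (hI2.const_mul _)).add (hI3.const_mul _)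
  · exact hI4
  · exact (((hI1.const_mul _).add (hI2.const_mul _)).add (hI3.const_mul _)).sub hI4
  · exact hI5.const_mul _

end Summit.RiemannHypothesis.RiemannHypothesis.Theorems.SuzukiThetaFlow

end
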